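import Mathlib
import Literature.AlgebraicGeometry.Resolution.CobordantGame
import Literature.AlgebraicGeometry.Resolution.CobordantChartCoefficients
import Literature.AlgebraicGeometry.Resolution.FormalCoordinateChange
import Summits.ResolutionOfSingularities.ResolutionOfSingularities.Theorems.WeightedInvariantLocalWeightedDropCharTwoDoublePointReduction
import Summits.ResolutionOfSingularities.ResolutionOfSingularities.Theorems.WeightedInvariantLocalWeightedDropWeierstrassForm
import Summits.ResolutionOfSingularities.ResolutionOfSingularities.Theorems.WeightedInvariantLocalWeightedDropAxisPreparationAux

/-!
# `WeightedInvariant.LocalWeightedDrop`, line `hasse-ridge-face-selection`: CORE W″ piece S3 (wild unary-cone surface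
# germs, `p ∣ d ≥ 3`) ⟺ the MONIC forms `y^d + Σ_{j<d} A_j(x₁,x₂) y^j` are won

Crux item stmt-ResolutionOfSingularities-8899 `LocalWeightedDrop` (route `ResolutionOfSingularities/WeightedInvariant`),
serving the door `WeightedConstruction` stmt-ResolutionOfSingularities-0571.  [OURS · L1 W4.3, chain w43, stub worker 1
(gen 2): step (w0) for the registered piece S3 `stub_wildUnaryConeSurfaceWon` of skeleton v20/v21 — the S3 twin of
`charTwoDoublePointSurfaceWon_of_monicForms` / `monicFormsWon_of_charTwoDoublePointSurfaceWon` (S2).  Not a statement of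
any manuscript.]

BOOKKEEPING ONLY.  The registered piece S3 (over `k = k̄` of characteristic `p`: a singular surface germ
`f ∈ k[[x₀,x₁,x₂]]` of order `d`, `p ∣ d`, `2 < d`, whose degree-`d` form has two linearly independent
translation-invariance vectors, is won — given the singular germs in `≤ 2` variables, the singular surface germs of
smaller order, and the same-order germs whose cone has apex dimension exactly one) is EQUIVALENT to the statement
«under the same side hypotheses every MONIC form `P(A) = y^d + Σ_{j<d} A_j(x') y^j` (`y = X (Fin.last 2)`,
`A_j ∈ k[[x₁,x₂]]`, `ord A_j > d - j`) is won»: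
* `wildUnaryConeSurfaceWon_of_monicForms`: straighten the cone (`UnaryConeForm.normalForm_of_wideApex`), pass to the
  Weierstrass form (`WeierstrassForm.exists_monic_of_polyhedronCond`), and transport the winning region back along the
  unit and the linear change (`won_unit_mul_iff`, `won_subst_iff`);
* `monicFormsWon_of_wildUnaryConeSurfaceWon`: a monic form with the polyhedron condition IS a singular germ of order
  `d` whose degree-`d` form is `y^d` (`WildUnaryConeMonic.initEval_monicForm`), invariant under the translations by
  `e₀, e₁`.
So the mathematics of S3 is isolated on the position space of `monicFormsWon_of_rank` (N3, every degree).
-/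

set_option linter.dupNamespace false -- mandated namespace of this single-conjunct summit

namespace Summit.ResolutionOfSingularities.ResolutionOfSingularities.Theorems

open Literature.AlgebraicGeometry.Resolution

namespace WildUnaryConeMonic

open MvPowerSeries Literature.AlgebraicGeometry.Resolution.CobordantGame

variable {k : Type} [Field k] {m : ℕ}

/-- A monic form `y^d + Σ_{j<d} A_j(x') y^j` with `ord A_j > d - j` has, in total degree `≤ d`, the single monomial
`y^d` (coefficient `1`). -/
theorem coeff_monicForm_of_degree_le {d : ℕ} (A : Fin d → MvPowerSeries (Fin m) k)
    (hA : ∀ j : Fin d, ((d - (j : ℕ) : ℕ) : ℕ∞) < (A j).order) (E : Fin (m + 1) →₀ ℕ) (hE : E.degree ≤ d) :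
    coeff E (X (Fin.last m) ^ d + ∑ j : Fin d, rename (Fin.succAboveEmb (Fin.last m)) (A j) * X (Fin.last m) ^ (j : ℕ)) =
      if E = Finsupp.single (Fin.last m) d then 1 else 0 := by
  classical
  obtain ⟨β, hEeq⟩ := TschirnhausForm.exists_eq_emb_add_single E
  set n := E (Fin.last m) with hn
  have hdeg : E.degree = β.degree + n := by rw [hEeq, TschirnhausForm.degree_emb_add_single]
  rw [hEeq, WeierstrassForm.coeff_monicForm]
  have hsum : (∑ j : Fin d, if (j : ℕ) = n then coeff β (A j) else 0) = 0 := by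
    refine Finset.sum_eq_zero fun j _ => ?_
    split_ifs with hj
    · apply coeff_of_lt_order
      refine lt_of_le_of_lt ?_ (hA j)
      have := j.2
      exact_mod_cast (by omega : β.degree ≤ d - (j : ℕ))
    · rfl
  rw [hsum, add_zero]
  by_cases hnd : n = d
  · have hβ : β = 0 := by
      have : β.degree = 0 := by omega
      exact (Finsupp.degree_eq_zero_iff β).mp this
    rw [if_pos hnd, hβ, coeff_zero_eq_constantCoeff_apply, map_one, if_pos]
    rw [Finsupp.embDomain_zero, zero_add, hnd]
  · rw [if_neg hnd, if_neg]
    intro h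
    have h' := DFunLike.congr_fun h (Fin.last m)
    rw [TschirnhausForm.emb_add_single_last, Finsupp.single_eq_same] at h'
    exact hnd h'

/-- A monic form with the polyhedron condition has order exactly `d`. -/
theorem order_monicForm {d : ℕ} (A : Fin d → MvPowerSeries (Fin m) k)
    (hA : ∀ j : Fin d, ((d - (j : ℕ) : ℕ) : ℕ∞) < (A j).order) :
    (X (Fin.last m) ^ d + ∑ j : Fin d, rename (Fin.succAboveEmb (Fin.last m)) (A j) * X (Fin.last m) ^ (j : ℕ)).order =
      (d : ℕ∞) := by
  refine le_antisymm ?_ (nat_le_order fun E hE => ?_)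
  · have h := order_le (f := X (Fin.last m) ^ d +
        ∑ j : Fin d, rename (Fin.succAboveEmb (Fin.last m)) (A j) * X (Fin.last m) ^ (j : ℕ))
      (d := Finsupp.single (Fin.last m) d) (by
        rw [coeff_monicForm_of_degree_le A hA _ (by rw [Finsupp.degree_single]), if_pos rfl]
        exact one_ne_zero)
    rw [Finsupp.degree_single] at h
    exact_mod_cast h
  · rw [coeff_monicForm_of_degree_le A hA E (by exact_mod_cast hE.le), if_neg]
    rintro rfl
    rw [Finsupp.degree_single] at hE
    exact absurd hE (lt_irrefl _)

/-- A monic form with the polyhedron condition and `d ≥ 2` is a singular germ. -/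
theorem isSingular_monicForm {d : ℕ} (hd : 2 ≤ d) (A : Fin d → MvPowerSeries (Fin m) k)
    (hA : ∀ j : Fin d, ((d - (j : ℕ) : ℕ) : ℕ∞) < (A j).order) :
    IsSingular k (X (Fin.last m) ^ d +
      ∑ j : Fin d, rename (Fin.succAboveEmb (Fin.last m)) (A j) * X (Fin.last m) ^ (j : ℕ)) := by
  have hord := order_monicForm A hA
  refine ⟨?_, (FormalCoordChange.two_le_order_iff _).mp ?_⟩
  · intro h
    rw [h, order_zero] at hord
    exact absurd hord (by simp)
  · rw [hord]
    exact_mod_cast hd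

/-- The degree-`d` form of a monic form with the polyhedron condition, as a function: `in_d P (v) = (v y)^d`. -/
theorem initEval_monicForm {d : ℕ} (A : Fin d → MvPowerSeries (Fin m) k)
    (hA : ∀ j : Fin d, ((d - (j : ℕ) : ℕ) : ℕ∞) < (A j).order) (v : Fin (m + 1) → k) :
    CobordantChart.initEval (fun _ : Fin (m + 1) => 1) v d
        (X (Fin.last m) ^ d + ∑ j : Fin d, rename (Fin.succAboveEmb (Fin.last m)) (A j) * X (Fin.last m) ^ (j : ℕ)) =
      v (Fin.last m) ^ d := by
  classical
  have hlin : (∑ l, C ((Pi.single (Fin.last m) (1 : k) : Fin (m + 1) → k) l) * X l : MvPowerSeries (Fin (m + 1)) k) =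
      X (Fin.last m) := by
    rw [Finset.sum_eq_single (Fin.last m)]
    · rw [Pi.single_eq_same, map_one, one_mul]
    · intro l _ hl
      rw [Pi.single_eq_of_ne hl, map_zero, zero_mul]
    · intro h
      exact absurd (Finset.mem_univ _) h
  have hcongr : CobordantChart.initEval (fun _ : Fin (m + 1) => 1) v d
      (X (Fin.last m) ^ d + ∑ j : Fin d, rename (Fin.succAboveEmb (Fin.last m)) (A j) * X (Fin.last m) ^ (j : ℕ)) =
      CobordantChart.initEval (fun _ : Fin (m + 1) => 1) v d
        ((∑ l, C ((Pi.single (Fin.last m) (1 : k) : Fin (m + 1) → k) l) * X l : MvPowerSeries (Fin (m + 1)) k) ^ d) := by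
    refine AxisPreparation.initEval_congr (fun E hE => ?_) v
    rw [coeff_monicForm_of_degree_le A hA E hE.le, hlin, coeff_X_pow]
  rw [hcongr, UnaryConeForm.initEval_linearForm_pow, dotProduct_comm, dotProduct_single, mul_one]

/-- The degree-`d` form `y^d` of a monic form is invariant under every translation `v ↦ v + c` with `c y = 0`. -/
theorem initEval_monicForm_add {d : ℕ} (A : Fin d → MvPowerSeries (Fin m) k)
    (hA : ∀ j : Fin d, ((d - (j : ℕ) : ℕ) : ℕ∞) < (A j).order) (c : Fin (m + 1) → k) (hc : c (Fin.last m) = 0)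
    (v : Fin (m + 1) → k) :
    CobordantChart.initEval (fun _ : Fin (m + 1) => 1) (v + c) d
        (X (Fin.last m) ^ d + ∑ j : Fin d, rename (Fin.succAboveEmb (Fin.last m)) (A j) * X (Fin.last m) ^ (j : ℕ)) =
      CobordantChart.initEval (fun _ : Fin (m + 1) => 1) v d
        (X (Fin.last m) ^ d + ∑ j : Fin d, rename (Fin.succAboveEmb (Fin.last m)) (A j) * X (Fin.last m) ^ (j : ℕ)) := by
  rw [initEval_monicForm A hA, initEval_monicForm A hA, Pi.add_apply, hc, add_zero]

/-- In three variables the translation vectors `e₀, e₁` (both with `y`-component `0`, `y = X 2`) are linearly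
independent. -/
theorem indep_single_zero_one :
    ∀ α β : k, α • (Pi.single (0 : Fin 3) (1 : k) : Fin 3 → k) + β • (Pi.single (1 : Fin 3) (1 : k) : Fin 3 → k) = 0 →
      α = 0 ∧ β = 0 := by
  intro α β h
  have h0 := congr_fun h 0
  have h1 := congr_fun h 1
  simp at h0 h1
  exact ⟨h0, h1⟩

end WildUnaryConeMonic

open WildUnaryConeMonic Literature.AlgebraicGeometry.Resolution.CobordantGame in
/-- S3 FROM THE MONIC FORMS (step (w0) of CHAIN w43 for `stub_wildUnaryConeSurfaceWon`).  Suppose that over every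
algebraically closed field of characteristic `p`, for every `d` with `p ∣ d`, `2 < d`, given (verbatim as in S3) the
singular germs in `≤ 2` variables, the singular surface germs of order `< d`, and the singular surface germs of order
`d` whose degree-`d` form has a non-zero translation-invariance vector but no two independent ones (the axis case),
every MONIC form `y^d + Σ_{j<d} A_j(x₁,x₂) y^j` with `ord A_j > d - j` (`y = X (Fin.last 2)`) is won.  Then the
registered piece `stub_wildUnaryConeSurfaceWon` holds (conclusion copied verbatim). -/
theorem wildUnaryConeSurfaceWon_of_monicForms
    (hmonic : ∀ (p : ℕ), p.Prime → ∀ (k : Type) [Field k] [CharP k p] [IsAlgClosed k],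
      (∀ m : ℕ, m < 3 → ∀ g : MvPowerSeries (Fin m) k,
        CobordantGame.IsSingular k g → CobordantGame.Won k m g) →
      ∀ (d : ℕ), p ∣ d → 2 < d →
      (∀ g : MvPowerSeries (Fin 3) k, CobordantGame.IsSingular k g → g.order < d →
        CobordantGame.Won k 3 g) →
      (∀ g : MvPowerSeries (Fin 3) k, CobordantGame.IsSingular k g → g.order = d →
        (∃ c : Fin 3 → k, c ≠ 0 ∧ ∀ v : Fin 3 → k,
          CobordantChart.initEval (fun _ : Fin 3 => 1) (v + c) d g =
            CobordantChart.initEval (fun _ : Fin 3 => 1) v d g) →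
        (∀ c₁ c₂ : Fin 3 → k,
          (∀ v : Fin 3 → k, CobordantChart.initEval (fun _ : Fin 3 => 1) (v + c₁) d g =
            CobordantChart.initEval (fun _ : Fin 3 => 1) v d g) →
          (∀ v : Fin 3 → k, CobordantChart.initEval (fun _ : Fin 3 => 1) (v + c₂) d g =
            CobordantChart.initEval (fun _ : Fin 3 => 1) v d g) →
          ∃ α β : k, (α ≠ 0 ∨ β ≠ 0) ∧ α • c₁ + β • c₂ = 0) →
        CobordantGame.Won k 3 g) →
      ∀ A : Fin d → MvPowerSeries (Fin 2) k, (∀ j : Fin d, ((d - (j : ℕ) : ℕ) : ℕ∞) < (A j).order) →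
        CobordantGame.Won k 3 (MvPowerSeries.X (Fin.last 2) ^ d +
          ∑ j : Fin d, MvPowerSeries.rename (Fin.succAboveEmb (Fin.last 2)) (A j) * MvPowerSeries.X (Fin.last 2) ^ (j : ℕ))) :
    ∀ (p : ℕ), p.Prime → ∀ (k : Type) [Field k] [CharP k p] [IsAlgClosed k],
      (∀ m : ℕ, m < 3 → ∀ g : MvPowerSeries (Fin m) k,
        CobordantGame.IsSingular k g → CobordantGame.Won k m g) →
      ∀ (f : MvPowerSeries (Fin 3) k), CobordantGame.IsSingular k f →
      (∀ g : MvPowerSeries (Fin 3) k, CobordantGame.IsSingular k g → g.order < f.order →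
        CobordantGame.Won k 3 g) →
      ∀ (d : ℕ), f.order = d → p ∣ d → 2 < d →
      (∀ g : MvPowerSeries (Fin 3) k, CobordantGame.IsSingular k g → g.order = d →
        (∃ c : Fin 3 → k, c ≠ 0 ∧ ∀ v : Fin 3 → k,
          CobordantChart.initEval (fun _ : Fin 3 => 1) (v + c) d g =
            CobordantChart.initEval (fun _ : Fin 3 => 1) v d g) →
        (∀ c₁ c₂ : Fin 3 → k,
          (∀ v : Fin 3 → k, CobordantChart.initEval (fun _ : Fin 3 => 1) (v + c₁) d g =
            CobordantChart.initEval (fun _ : Fin 3 => 1) v d g) →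
          (∀ v : Fin 3 → k, CobordantChart.initEval (fun _ : Fin 3 => 1) (v + c₂) d g =
            CobordantChart.initEval (fun _ : Fin 3 => 1) v d g) →
          ∃ α β : k, (α ≠ 0 ∨ β ≠ 0) ∧ α • c₁ + β • c₂ = 0) →
        CobordantGame.Won k 3 g) →
      (∃ c₁ c₂ : Fin 3 → k, (∀ α β : k, α • c₁ + β • c₂ = 0 → α = 0 ∧ β = 0) ∧
        (∀ v : Fin 3 → k, CobordantChart.initEval (fun _ : Fin 3 => 1) (v + c₁) d f =
          CobordantChart.initEval (fun _ : Fin 3 => 1) v d f) ∧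
        (∀ v : Fin 3 → k, CobordantChart.initEval (fun _ : Fin 3 => 1) (v + c₂) d f =
          CobordantChart.initEval (fun _ : Fin 3 => 1) v d f)) →
      CobordantGame.Won k 3 f := by
  intro p hp k _ _ _ hlow f _ hord d hfd hpd h2d haxis hwide
  obtain ⟨c₁, c₂, hind, h₁, h₂⟩ := hwide
  obtain ⟨M, U, a, hMdet, hU, ha, hfeq⟩ := UnaryConeForm.normalForm_of_wideApex f d hfd c₁ c₂ hind h₁ h₂
  have hPF := WeierstrassForm.polyhedronCond_normalForm U a ha
  have htop : MvPowerSeries.coeff (Finsupp.single (Fin.last 2) d) (U * MvPowerSeries.X (Fin.last 2) ^ d +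
      ∑ j : Fin d, MvPowerSeries.rename (Fin.succAboveEmb (Fin.last 2)) (a j) * MvPowerSeries.X (Fin.last 2) ^ (j : ℕ)) ≠
      0 := by
    rw [WeierstrassForm.coeff_single_normalForm]
    exact hU
  obtain ⟨H, A, hH, hA, hFeq⟩ := WeierstrassForm.exists_monic_of_polyhedronCond _ hPF htop
  have hord' : ∀ g : MvPowerSeries (Fin 3) k, CobordantGame.IsSingular k g → g.order < d →
      CobordantGame.Won k 3 g := fun g hg hlt => hord g hg (by rw [hfd]; exact hlt)
  have hW := hmonic p hp k hlow d hpd h2d hord' haxis A hA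
  have hW' : CobordantGame.Won k 3 (MvPowerSeries.subst (FormalCoordChange.linSubst M) f) := by
    rw [hfeq, hFeq]
    exact (won_unit_mul_iff hH _).mpr hW
  exact (won_subst_iff (ConeDichotomy.constantCoeff_linSubst M)
    (by rw [CharTwoDoublePoint.linMat_linSubst]; exact hMdet) f).mp hW'

open WildUnaryConeMonic Literature.AlgebraicGeometry.Resolution.CobordantGame in
/-- THE CONVERSE BOOKKEEPING: the registered piece `stub_wildUnaryConeSurfaceWon` (as a hypothesis, verbatim) wins every
monic form `y^d + Σ_{j<d} A_j(x₁,x₂) y^j` with `ord A_j > d - j`, `p ∣ d`, `2 < d`, under the same side hypotheses — a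
monic form is itself a singular order-`d` germ whose degree-`d` form `y^d` is invariant under the translations by
`e₀, e₁`.  Hence S3 is EQUIVALENT to «all monic forms are won». -/
theorem monicFormsWon_of_wildUnaryConeSurfaceWon
    (hS3 : ∀ (p : ℕ), p.Prime → ∀ (k : Type) [Field k] [CharP k p] [IsAlgClosed k],
      (∀ m : ℕ, m < 3 → ∀ g : MvPowerSeries (Fin m) k,
        CobordantGame.IsSingular k g → CobordantGame.Won k m g) →
      ∀ (f : MvPowerSeries (Fin 3) k), CobordantGame.IsSingular k f →
      (∀ g : MvPowerSeries (Fin 3) k, CobordantGame.IsSingular k g → g.order < f.order →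
        CobordantGame.Won k 3 g) →
      ∀ (d : ℕ), f.order = d → p ∣ d → 2 < d →
      (∀ g : MvPowerSeries (Fin 3) k, CobordantGame.IsSingular k g → g.order = d →
        (∃ c : Fin 3 → k, c ≠ 0 ∧ ∀ v : Fin 3 → k,
          CobordantChart.initEval (fun _ : Fin 3 => 1) (v + c) d g =
            CobordantChart.initEval (fun _ : Fin 3 => 1) v d g) →
        (∀ c₁ c₂ : Fin 3 → k,
          (∀ v : Fin 3 → k, CobordantChart.initEval (fun _ : Fin 3 => 1) (v + c₁) d g =
            CobordantChart.initEval (fun _ : Fin 3 => 1) v d g) →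
          (∀ v : Fin 3 → k, CobordantChart.initEval (fun _ : Fin 3 => 1) (v + c₂) d g =
            CobordantChart.initEval (fun _ : Fin 3 => 1) v d g) →
          ∃ α β : k, (α ≠ 0 ∨ β ≠ 0) ∧ α • c₁ + β • c₂ = 0) →
        CobordantGame.Won k 3 g) →
      (∃ c₁ c₂ : Fin 3 → k, (∀ α β : k, α • c₁ + β • c₂ = 0 → α = 0 ∧ β = 0) ∧
        (∀ v : Fin 3 → k, CobordantChart.initEval (fun _ : Fin 3 => 1) (v + c₁) d f =
          CobordantChart.initEval (fun _ : Fin 3 => 1) v d f) ∧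
        (∀ v : Fin 3 → k, CobordantChart.initEval (fun _ : Fin 3 => 1) (v + c₂) d f =
          CobordantChart.initEval (fun _ : Fin 3 => 1) v d f)) →
      CobordantGame.Won k 3 f) :
    ∀ (p : ℕ), p.Prime → ∀ (k : Type) [Field k] [CharP k p] [IsAlgClosed k],
      (∀ m : ℕ, m < 3 → ∀ g : MvPowerSeries (Fin m) k,
        CobordantGame.IsSingular k g → CobordantGame.Won k m g) →
      ∀ (d : ℕ), p ∣ d → 2 < d →
      (∀ g : MvPowerSeries (Fin 3) k, CobordantGame.IsSingular k g → g.order < d →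
        CobordantGame.Won k 3 g) →
      (∀ g : MvPowerSeries (Fin 3) k, CobordantGame.IsSingular k g → g.order = d →
        (∃ c : Fin 3 → k, c ≠ 0 ∧ ∀ v : Fin 3 → k,
          CobordantChart.initEval (fun _ : Fin 3 => 1) (v + c) d g =
            CobordantChart.initEval (fun _ : Fin 3 => 1) v d g) →
        (∀ c₁ c₂ : Fin 3 → k,
          (∀ v : Fin 3 → k, CobordantChart.initEval (fun _ : Fin 3 => 1) (v + c₁) d g =
            CobordantChart.initEval (fun _ : Fin 3 => 1) v d g) →
          (∀ v : Fin 3 → k, CobordantChart.initEval (fun _ : Fin 3 => 1) (v + c₂) d g =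
            CobordantChart.initEval (fun _ : Fin 3 => 1) v d g) →
          ∃ α β : k, (α ≠ 0 ∨ β ≠ 0) ∧ α • c₁ + β • c₂ = 0) →
        CobordantGame.Won k 3 g) →
      ∀ A : Fin d → MvPowerSeries (Fin 2) k, (∀ j : Fin d, ((d - (j : ℕ) : ℕ) : ℕ∞) < (A j).order) →
        CobordantGame.Won k 3 (MvPowerSeries.X (Fin.last 2) ^ d +
          ∑ j : Fin d, MvPowerSeries.rename (Fin.succAboveEmb (Fin.last 2)) (A j) * MvPowerSeries.X (Fin.last 2) ^ (j : ℕ)) := by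
  intro p hp k _ _ _ hlow d hpd h2d hord haxis A hA
  have hPo := order_monicForm A hA
  have hPs := isSingular_monicForm (by omega) A hA
  refine hS3 p hp k hlow _ hPs (fun g hg hlt => hord g hg (by rw [hPo] at hlt; exact hlt)) d hPo hpd h2d haxis
    ⟨(Pi.single (0 : Fin 3) (1 : k) : Fin 3 → k), (Pi.single (1 : Fin 3) (1 : k) : Fin 3 → k), indep_single_zero_one,
      fun v => initEval_monicForm_add A hA _ (by simp) v,
      fun v => initEval_monicForm_add A hA _ (by simp) v⟩

end Summit.ResolutionOfSingularities.ResolutionOfSingularities.Theorems
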